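import Mathlib
import HarnessLib
import Summits.HubbardSuperconductivity.HubbardSuperconductivity.Theorems.KLProgrammeH10TwoPointLimitSymbolFrameInstance
import Summits.HubbardSuperconductivity.HubbardSuperconductivity.Theorems.KLProgrammeH10TwoPointLimitSymbolProductSampledZone

/-!
# Route `KLProgramme` — engine support, route (L2): the POINTWISE second differences of the two-multiplier symbol
# `F_{ω₁}(k)F_{ω₂}(k)` (`klAnisoFamily` at scales `n₂ ≤ n₁` on an admissible frame) in the time direction and in an arbitrary integer
# spatial direction — the inputs `h₀…h₃` of `sum_norm_charSum_le_of_second_differences` for the overlap size `B` of BGM (2.71a)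

Cell `gate-hubbard-kl`, seat p4 (C5a lead), g6; HOME/prover-p4/FRAME-L22-NOTE.md §2/§3″ (d).  Assembles the symbol layer:
`…SymbolProductSampled(Zone)` (generic pointwise bounds) on the instance `…SymbolFrameInstance` (identification, zone, cell, window),
`…SymbolFrameBand` (band sizes `K₂ = 4 + 4A`, Fermi region, zone margin), `…SymbolAngularFactor` (angular line bounds), `…SymbolFrameProfile`
(profile sizes with the surrogate constant `d`).  For the sampled symbol `G̃(q) = F_{ω₁}(k(q))F_{ω₂}(k(q))` on `(ℤ/2Mℤ)¹ × (ℤ/Lℤ)²`: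
* `norm_klAnisoPair_le_one` — `‖G̃‖ ≤ 1`;
* **`norm_fwdDiff_two_time_klAnisoPair_le`** — `‖Δ²_{(1,0)} G̃(q)‖ ≤ (4g₂ + 2g₁)(2π/β)²/Λ_{n₁}²` (`Λ_{n₁}β < π(2M−3)`);
* **`norm_fwdDiff_two_space_klAnisoPair_le`** — for an integer step `u` with `4π|u_j| ≤ zL` and a tangency datum `|De_K(p_F)(2πu/L)| ≤ τ₀`:
  `‖Δ²_{(0,ū)} G̃(q)‖ ≤ (4g₂+2g₁)τ²/Λ² + 2g₁K₂‖w‖²/Λ + 4g₁τ/Λ·z₁ + z₂`, `τ = τ₀ + K₂(ρ + 2‖w‖)‖w‖`, `w = 2πu/L`, `K₂ = 4+4A`,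
  `ρ` the cell radius, `z₁, z₂` the angular line constants — valid for EVERY `q`;
with `g₁ = 2d e₀²`, `g₂ = (2d + 2d²) e₀⁴` (`d ≥ |bgmCutoffSq′|, |bgmCutoffSq″|`).  Everything is proved; no definitions, no named facts. [folklore]
-/

noncomputable section

namespace Summit.HubbardSuperconductivity.HubbardSuperconductivity.Theorems.TorusFourierL2

set_option linter.dupNamespace false -- summit = problem name (single-conjunct summit), D-0017

open Set Literature.MathematicalPhysics.QuantumLattice Literature.MathematicalPhysics.QuantumLattice.BandSectorCounting
open Literature.MathematicalPhysics.QuantumLattice.FermiRG Literature.Probability.LatticeModels Literature.Analysis.SpecialFunctions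
open Summit.HubbardSuperconductivity.HubbardSuperconductivity.Theorems.DispersionFlow
open Summit.HubbardSuperconductivity.HubbardSuperconductivity.Theorems.KLRegimeSplit
open Summit.HubbardSuperconductivity.HubbardSuperconductivity.Theorems.KLProgrammeLegKernels
open Summit.HubbardSuperconductivity.HubbardSuperconductivity.Theorems.PerturbedFermiCurve
open scoped Real

section Pair

variable {L M : ℕ} [NeZero L] [NeZero M] {a b : ℝ} (B : BandBounds a b) {K : TrigPolyC4v} {A : ℝ}
  (hA : ∀ p : Momentum, ∀ j ≤ 2, ‖iteratedFDeriv ℝ j (frameShift K) p‖ ≤ A) (hADt : 2 * A < B.Dtmin)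
  {μ e₀ z β : ℝ} (he : 0 < e₀) (hz : 0 < z) (hz1 : z ≤ 1) (hgap : e₀ + A + z ^ 2 < -μ) (h3 : e₀ + A - μ ≤ 3)
  (hlo : a ≤ μ - A - e₀) (hhi : μ + A + e₀ ≤ b) (hβ : 0 < β)
  {n₁ n₂ : ℕ} (hn : n₂ ≤ n₁) (ω₁ : Fin (sectorCount n₁)) (ω₂ : Fin (sectorCount n₂))
  {d : ℝ} (hd : 0 ≤ d) (hd1 : ∀ u, |deriv (bgmCutoffSq e₀) u| ≤ d) (hd2 : ∀ u, |iteratedDeriv 2 (bgmCutoffSq e₀) u| ≤ d)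
  {Z : (Fin 2 → ℝ) → ℝ}
  (hZ : ∀ p, Z p = gnCutoff ((π + z) ^ 2 / π ^ 2) ((π + z) ^ 2) (p 0 ^ 2) * gnCutoff ((π + z) ^ 2 / π ^ 2) ((π + z) ^ 2) (p 1 ^ 2) *
    ((radialCutoffC (1 / 2) (momToComplex p) * sectorWeightCirc n₁ ((ω₁ : ℕ) : ℤ) (polarAngle p)) *
      (radialCutoffC (1 / 2) (momToComplex p) * sectorWeightCirc n₂ ((ω₂ : ℕ) : ℤ) (polarAngle p))))
  {Φ : ℝ × (Fin 2 → ℝ) → ℂ}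
  (hΦ : ∀ k₀ p, Φ (k₀, p) = ((bgmCutoffSq e₀ ((16 : ℝ) ^ n₁ * (k₀ ^ 2 + frameLevel μ K (WithLp.toLp 2 p) ^ 2)) *
      bgmCutoffSq e₀ ((16 : ℝ) ^ n₂ * (k₀ ^ 2 + frameLevel μ K (WithLp.toLp 2 p) ^ 2)) * Z p : ℝ) : ℂ))
  {Gs : TorusSite 1 (2 * M) × TorusSite 2 L → ℂ}
  (hGs : ∀ q, Gs q = klAnisoFamily L M β μ K e₀ n₁ ω₁ (⟨(q.1 0).val, ZMod.val_lt (q.1 0)⟩, q.2) *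
    klAnisoFamily L M β μ K e₀ n₂ ω₂ (⟨(q.1 0).val, ZMod.val_lt (q.1 0)⟩, q.2))

include hA he hz h3 hZ hΦ hGs in
/-- The sampled symbol IS the sample of `Φ` (restated in the sampling convention of `…SymbolProductSampled`). [folklore] -/
theorem klAnisoPair_eq_sample (q : TorusSite 1 (2 * M) × TorusSite 2 L) :
    Gs q = Φ (π * (1 - 2 * M) / β + 2 * π / β * (((q.1 0).val : ℕ) : ℝ), fun j => 2 * π / L * (((q.2 j).valMinAbs : ℤ) : ℝ)) := by
  rw [hGs]; exact klAniso_mul_klAniso_eq_symbol hA he hz h3 ω₁ ω₂ hZ hΦ q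

include hZ hΦ hGs hA he hz h3 in
/-- **`‖G̃‖ ≤ 1`.** [folklore] -/
theorem norm_klAnisoPair_le_one (q : TorusSite 1 (2 * M) × TorusSite 2 L) : ‖Gs q‖ ≤ 1 := by
  rw [klAnisoPair_eq_sample hA he hz h3 ω₁ ω₂ hZ hΦ hGs q, hΦ, Complex.norm_real, Real.norm_eq_abs, abs_mul, abs_mul]
  have h1 := abs_bgmCutoffSq_le_one e₀ ((16 : ℝ) ^ n₁ * ((π * (1 - 2 * M) / β + 2 * π / β * (((q.1 0).val : ℕ) : ℝ)) ^ 2 +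
    frameLevel μ K (WithLp.toLp 2 fun j => 2 * π / L * (((q.2 j).valMinAbs : ℤ) : ℝ)) ^ 2))
  have h2 := abs_bgmCutoffSq_le_one e₀ ((16 : ℝ) ^ n₂ * ((π * (1 - 2 * M) / β + 2 * π / β * (((q.1 0).val : ℕ) : ℝ)) ^ 2 +
    frameLevel μ K (WithLp.toLp 2 fun j => 2 * π / L * (((q.2 j).valMinAbs : ℤ) : ℝ)) ^ 2))
  have h3' := abs_angularFactor_le_one hZ (fun j => 2 * π / L * (((q.2 j).valMinAbs : ℤ) : ℝ))
  calc _ ≤ 1 * 1 * 1 := mul_le_mul (mul_le_mul h1 h2 (abs_nonneg _) zero_le_one) h3' (abs_nonneg _) (by norm_num)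
    _ = 1 := by norm_num

include hA he hz h3 hβ hn hd hd1 hd2 hZ hΦ hGs in
/-- **Time direction**: `‖Δ²_{(1,0)} G̃(q)‖ ≤ (4g₂ + 2g₁)(2π/β)²/Λ_{n₁}²` for every `q`, provided `Λ_{n₁}β < π(2M − 3)`.
[cite: BenfattoGiulianiMastropietro2006, §2.5 Lemma 2.2 (2.52), (2.56)] -/
theorem norm_fwdDiff_two_time_klAnisoPair_le (hM : klScale e₀ n₁ * β < π * (2 * M - 3)) (q : TorusSite 1 (2 * M) × TorusSite 2 L) :
    ‖((fwdDiff ((fun _ : Fin 1 => (1 : ZMod (2 * M))), (0 : TorusSite 2 L)))^[2] Gs) q‖ ≤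
      (4 * ((d * e₀ ^ 4 * 1 + 2 * (d * e₀ ^ 2) * (d * e₀ ^ 2) + 1 * (d * e₀ ^ 4))) + 2 * (d * e₀ ^ 2 * 1 + 1 * (d * e₀ ^ 2))) *
        (2 * π / β) ^ 2 * 1 / klScale e₀ n₁ ^ 2 := by
  obtain ⟨hGc, -, hG1, hG2, hGv⟩ := scaleProfile_mul_bounds he hn hd hd1 hd2
  have hΛ : 0 < klScale e₀ n₁ := by rw [klScale]; positivity
  exact norm_fwdDiff_two_time_sampledSymbol_le hGc hΛ (by positivity) (by positivity) hG1 hG2 hGv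
    (fun p : Fin 2 → ℝ => frameLevel μ K (WithLp.toLp 2 p)) Z (abs_angularFactor_le_one hZ) Φ (fun k₀ p => hΦ k₀ p)
    (π * (1 - 2 * M) / β) (2 * π / β) (2 * π / L) (fun m hm => symbol_window hβ hM m hm) Gs
    (klAnisoPair_eq_sample hA he hz h3 ω₁ ω₂ hZ hΦ hGs) q

include B hA hADt he hz hz1 hgap h3 hlo hhi hn hd hd1 hd2 hZ hΦ hGs in
/-- **Space direction along an integer step `u`** (`w = (2π/L)u`, `4π|u_j| ≤ zL`), with a tangency datum `|De_K(p_F)w| ≤ τ₀` at the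
cell's Fermi point `p_F = klFermiPoint μ K θ_{n₂,ω₂}` and the angular constant `B_a` of
`exists_norm_iteratedDeriv_sectorWeightCirc_polarAngle_line_le 2`: for EVERY `q`,
`‖Δ²_{(0,ū)} G̃(q)‖ ≤ ((4g₂+2g₁)τ²/Λ² + 2g₁K₂‖w‖²/Λ)·1 + 4g₁τ/Λ·z₁ + 1·z₂`, `τ = τ₀ + K₂(ρ + 2‖w‖)‖w‖`, `K₂ = 4 + 4A`,
`ρ = (Λ + s_max Dt_min(3w_{n₂}/4))/(Dt_min − 2A)`, `z₁ = 2B_a(D₁+D₂)`, `z₂ = 2B_a(D₁²+D₂²) + 8B_a²D₁D₂`, `Dᵢ = (1+2/w_{nᵢ})‖w₁+iw₂‖`.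
[cite: BenfattoGiulianiMastropietro2006, §2.5 Lemma 2.2 (2.53)–(2.55), §2.7 (2.71a)] -/
theorem norm_fwdDiff_two_space_klAnisoPair_le {Ba : ℝ} (hB0 : 0 ≤ Ba)
    (hB : ∀ (i : ℕ), i ≤ 2 → ∀ (n : ℕ) (ω : ℤ) (θ₀ : ℝ) (q w : Fin 2 → ℝ) (t : ℝ) {r₀ : ℝ}, 0 < r₀ →
      r₀ ≤ ‖momToComplex (q + t • w)‖ → |sectorRelAngle θ₀ (q + t • w)| < π →
      ‖iteratedDeriv i (fun t : ℝ => sectorWeightCirc n ω (polarAngle (q + t • w))) t‖ ≤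
        (2 : ℕ).factorial * Ba * ((1 + (sectorWidth n)⁻¹ * (2 : ℕ).factorial) * ‖momToComplex w‖ / r₀) ^ i)
    (u : Fin 2 → ℤ) (hu : ∀ j, 2 * |2 * π / L| * |(u j : ℝ)| ≤ z) {τ₀ : ℝ}
    (hτ₀ : |fderiv ℝ (fun p : Fin 2 → ℝ => frameLevel μ K (WithLp.toLp 2 p)) (klFermiPoint μ K (sectorCenter n₂ (ω₂ : ℕ)))
      (fun j => 2 * π / L * (u j : ℝ))| ≤ τ₀)
    (q : TorusSite 1 (2 * M) × TorusSite 2 L) :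
    ‖((fwdDiff ((0 : TorusSite 1 (2 * M)), (fun j => ((u j : ℤ) : ZMod L))))^[2] Gs) q‖ ≤
      ((4 * (d * e₀ ^ 4 * 1 + 2 * (d * e₀ ^ 2) * (d * e₀ ^ 2) + 1 * (d * e₀ ^ 4)) + 2 * (d * e₀ ^ 2 * 1 + 1 * (d * e₀ ^ 2))) *
          (τ₀ + (4 + 4 * A) * ((klScale e₀ n₁ + B.smax * B.Dtmin * (3 * sectorWidth n₂ / 4)) / (B.Dtmin - 2 * A) +
            2 * ‖(fun j => 2 * π / L * (u j : ℝ))‖) * ‖(fun j => 2 * π / L * (u j : ℝ))‖) ^ 2 / klScale e₀ n₁ ^ 2 +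
          2 * (d * e₀ ^ 2 * 1 + 1 * (d * e₀ ^ 2)) * ((4 + 4 * A) * ‖(fun j => 2 * π / L * (u j : ℝ))‖ ^ 2) / klScale e₀ n₁) * 1 +
        4 * (d * e₀ ^ 2 * 1 + 1 * (d * e₀ ^ 2)) *
          (τ₀ + (4 + 4 * A) * ((klScale e₀ n₁ + B.smax * B.Dtmin * (3 * sectorWidth n₂ / 4)) / (B.Dtmin - 2 * A) +
            2 * ‖(fun j => 2 * π / L * (u j : ℝ))‖) * ‖(fun j => 2 * π / L * (u j : ℝ))‖) / klScale e₀ n₁ *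
          (2 * Ba * (((1 + 2 * (sectorWidth n₁)⁻¹) * ‖momToComplex (fun j => 2 * π / L * (u j : ℝ))‖) +
            ((1 + 2 * (sectorWidth n₂)⁻¹) * ‖momToComplex (fun j => 2 * π / L * (u j : ℝ))‖))) +
        1 * 1 * (2 * Ba * (((1 + 2 * (sectorWidth n₁)⁻¹) * ‖momToComplex (fun j => 2 * π / L * (u j : ℝ))‖) ^ 2 +
            ((1 + 2 * (sectorWidth n₂)⁻¹) * ‖momToComplex (fun j => 2 * π / L * (u j : ℝ))‖) ^ 2) +
          8 * Ba ^ 2 * (((1 + 2 * (sectorWidth n₁)⁻¹) * ‖momToComplex (fun j => 2 * π / L * (u j : ℝ))‖) *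
            ((1 + 2 * (sectorWidth n₂)⁻¹) * ‖momToComplex (fun j => 2 * π / L * (u j : ℝ))‖))) := by
  obtain ⟨hGc, hG0, hG1, hG2, hGv⟩ := scaleProfile_mul_bounds he hn hd hd1 hd2
  have hΛ : 0 < klScale e₀ n₁ := by rw [klScale]; positivity
  have hΛe : klScale e₀ n₁ ≤ e₀ := klScale_le_e0 he.le n₁
  have hL : (0 : ℝ) < L := Nat.cast_pos.2 (Nat.pos_of_ne_zero (NeZero.ne L))
  set w : Fin 2 → ℝ := fun j => 2 * π / L * (u j : ℝ) with hw
  set eK : (Fin 2 → ℝ) → ℝ := fun p => frameLevel μ K (WithLp.toLp 2 p) with heK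
  have hDt : 0 < B.Dtmin - 2 * A := by linarith
  have hρ : 0 ≤ (klScale e₀ n₁ + B.smax * B.Dtmin * (3 * sectorWidth n₂ / 4)) / (B.Dtmin - 2 * A) := by
    have := B.smax_pos; have := B.Dtmin_pos; have := sectorWidth_pos n₂; positivity
  have hD : ∀ n : ℕ, 0 ≤ (1 + 2 * (sectorWidth n)⁻¹) * ‖momToComplex w‖ := fun n => by
    have := sectorWidth_pos n; positivity
  -- points of the enlarged square in the shell are in the open square and in the Fermi region
  have hinner : ∀ p : Fin 2 → ℝ, (∀ i, |p i| ≤ π + z) → |eK p| ≤ klScale e₀ n₁ → (∀ i, |p i| < π) ∧ 1 ≤ ‖momToComplex p‖ := by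
    intro p hsq hshell
    refine ⟨fun i => ?_, one_le_norm_of_frameBand_le hA h3 (hshell.trans hΛe)⟩
    by_contra hge
    push Not at hge
    have h1 : π - z ≤ |p i| := by linarith
    have := frameBand_zone hA hz1 hgap h1 (hsq i)
    exact absurd (hshell.trans hΛe) (not_le.2 this)
  have hZ1 : ∀ (p₀ : Fin 2 → ℝ) (s : ℝ), (∀ i, |(p₀ + s • w) i| ≤ π + z) → |eK (p₀ + s • w)| ≤ klScale e₀ n₁ →
      |deriv (fun s : ℝ => Z (p₀ + s • w)) s| ≤
        2 * Ba * (((1 + 2 * (sectorWidth n₁)⁻¹) * ‖momToComplex w‖) + ((1 + 2 * (sectorWidth n₂)⁻¹) * ‖momToComplex w‖)) := by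
    intro p₀ s hsq hshell
    obtain ⟨hin, hfermi⟩ := hinner _ hsq hshell
    exact (abs_derivs_angularFactor_line_le hz hZ hB0 hB p₀ w hin hfermi).1
  have hZ2 : ∀ (p₀ : Fin 2 → ℝ) (s : ℝ), (∀ i, |(p₀ + s • w) i| ≤ π + z) → |eK (p₀ + s • w)| ≤ klScale e₀ n₁ →
      |iteratedDeriv 2 (fun s : ℝ => Z (p₀ + s • w)) s| ≤
        2 * Ba * (((1 + 2 * (sectorWidth n₁)⁻¹) * ‖momToComplex w‖) ^ 2 + ((1 + 2 * (sectorWidth n₂)⁻¹) * ‖momToComplex w‖) ^ 2) +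
          8 * Ba ^ 2 * (((1 + 2 * (sectorWidth n₁)⁻¹) * ‖momToComplex w‖) * ((1 + 2 * (sectorWidth n₂)⁻¹) * ‖momToComplex w‖)) := by
    intro p₀ s hsq hshell
    obtain ⟨hin, hfermi⟩ := hinner _ hsq hshell
    exact (abs_derivs_angularFactor_line_le hz hZ hB0 hB p₀ w hin hfermi).2
  have hxL : |2 * π / (L : ℝ)| * L = 2 * π := by
    rw [abs_of_pos (by positivity)]; field_simp
  exact norm_fwdDiff_two_space_sampledSymbol_le' hGc hΛ (by norm_num) (by positivity) (by positivity) hG0 hG1 hG2 hGv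
    (contDiff_frameBand μ K) (norm_iteratedFDeriv_two_frameBand_le hA μ) (contDiff_angularFactor hZ) zero_le_one
    (mul_nonneg (mul_nonneg (by norm_num) hB0) (add_nonneg (hD n₁) (hD n₂)))
    (add_nonneg (mul_nonneg (mul_nonneg (by norm_num) hB0) (add_nonneg (sq_nonneg _) (sq_nonneg _)))
      (mul_nonneg (by positivity) (mul_nonneg (hD n₁) (hD n₂))))
    (abs_angularFactor_le_one hZ) w hZ1 hZ2 hρ hτ₀
    (fun p hsq hshell hZp => symbol_cell B hA hADt he hz hz1 hgap hlo hhi ω₁ ω₂ hZ p hsq hshell hZp)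
    Φ (fun k₀ p => hΦ k₀ p) (π * (1 - 2 * M) / β) (2 * π / β) (2 * π / L) u rfl hu
    (fun k₀ p hp => symbol_zone hA he hz hz1 hgap ω₁ ω₂ hZ hΦ k₀ p hp) hxL Gs
    (klAnisoPair_eq_sample hA he hz h3 ω₁ ω₂ hZ hΦ hGs) q

end Pair

end Summit.HubbardSuperconductivity.HubbardSuperconductivity.Theorems.TorusFourierL2

end
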